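import Mathlib
import Summits.NavierStokesRegularity.NavierStokesRegularity.Theorems.EulerZoomLiouvillePowerGaugeEulerLiouvillePressureBudgetRieszPoisson
import Summits.NavierStokesRegularity.NavierStokesRegularity.Theorems.EulerZoomLiouvillePowerGaugeEulerLiouvillePressureBudgetNearFieldLog
import HarnessLib

/-!
# Crux `EulerZoomLiouville.PowerGaugeEulerLiouville` (stmt-NavierStokesRegularity-19832), t60-ΠLOG piece S4 (nsreg-p2 `r58/Sketch58c.lean`), part 3/3:
# ★ `rieszModConst : NsregP2.R58c.RieszModConst ρ` — THE RIESZ PRESSURE MODULO CONSTANTS OF A `C²` FIELD WITH THE DYADIC `L²` BUDGET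

Route №10 `EulerZoomLiouville` (NavierStokesRegularity), crux E = stmt-NavierStokesRegularity-19832; width seat ns-ezl-w1 g10 under the LEAD ns-typeII-p2
(KEY S58c-4; composer of record for `ScaleRepresentation` / t60-ΠLOG: ns-ezl-w3).

WITNESS: `Q[V] = −nearPotential ½ 1 V − farPotentialMod ½ 1 0 V` (parts 1–2).  This file proves
* `continuous_rieszMod` — `Q[V]` is continuous (hence locally integrable): the near potential is `C⁰` for `V ∈ C²` (tree), the renormalised far potential
  is continuous under the budget (part 1);
* `exists_localisation` — at every scale `N > 0` a `C²_c` localisation `w = χ_N V` (`ContDiffBump`, `= V` on `B(0,2N)`, `|w| ≤ |V|`);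
* `integral_farDifference_mul_laplacian_eq_zero` — the renormalised far DIFFERENCE of the localisation identity is weakly harmonic on `B(0,N)`:
  Fubini under the budget dominator, Green's identity against the far kernel (tree `integral_fderiv2_newtonFar_apply_mul_laplacian`), and `D²λ(x−y) = 0` for
  `|x−y| ≥ 1` (the source of the difference lives in `|y| ≥ 2N`, the test function in `|x| < N`);
* ★ `integral_rieszMod_mul_laplacian` — THE WEAK POISSON EQUATION `∫ Q[V] Δφ = −∫ D²φ(V,V)`: on `tsupport φ ⊆ B(0,N)`, `Q[V] = p̃[w_N] + κ − E` by the
  localisation identity, `∫ p̃[w_N]Δφ = −∫D²φ(w_N,w_N) = −∫D²φ(V,V)` (tree `integral_normalisedPressure_mul_laplacian_of_memLp`), `∫Δφ = 0`, `∫EΔφ = 0`;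
* ★★ `rieszModConst (ρ)` — `NsregP2.R58c.RieszModConst ρ` VERBATIM (defs `VelocityBudget`, `SolvesPressurePoisson` δ-unfolded): for `V ∈ C²` with the
  velocity budget and `ρ > −3/2` there is `Q ∈ L¹_loc` solving the pressure Poisson equation weakly such that at every scale `R ≥ 1`, for every `C²_c`
  localisation `w` (`= V` on `B_{2R}`, `|w| ≤ |V|`), `|Q − c − p̃[w]| ≤ D R^{−2−2ρ}` a.e. (in fact everywhere) on `B_R`, `D = 2·M·C_ρ·A`.

WHAT THIS IS NOT: not NS, not E, not the crux: an instrument piece (t60-ΠLOG S4: the scale-by-scale pressure representation modulo constants) bearing on the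
bookkeeping of 19832; 19832 OPEN; no summit statement is proved by this file.
[cite: Seregin2014, §6.2 Lemma 6.5; GilbargTrudinger2001, Lemma 4.2; Stein1970, Ch. II §2 Thm 1 (b); Tao2011, (35)]
-/

noncomputable section

-- flat `Theorems/<Route><Decl>…` files of one crux share the namespace of the crux (tree convention)
set_option linter.dupNamespace false

open MeasureTheory Set Filter Topology Metric Function
open scoped NNReal ENNReal RealInnerProductSpace ContDiff Laplacian

namespace Summit.NavierStokesRegularity.NavierStokesRegularity.Theorems.PowerGaugeEulerLiouville.PressureSeam

open Literature.Analysis Literature.Analysis.FluidPDE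
open Literature.Analysis.FluidPDE.RieszPressureModConst

-- nested operator types `ℝ³ →L[ℝ] ℝ³ →L[ℝ] ℝ³ →L[ℝ] ℝ`
set_option maxSynthPendingDepth 3

/-! ### Small tools -/

/-- `∫ Δφ = 0` for `φ ∈ C²_c`. [folklore] -/
theorem integral_laplacian_eq_zero {φ : EuclideanSpace ℝ (Fin 3) → ℝ} (hφ : ContDiff ℝ 2 φ) (hφc : HasCompactSupport φ) :
    ∫ x, (Δ φ) x = 0 := by
  have h := integral_mul_laplacian_comm (f := fun _ : EuclideanSpace ℝ (Fin 3) => (1 : ℝ)) contDiff_const hφ hφc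
  simp only [InnerProductSpace.laplacian_const, Pi.zero_apply, mul_zero, integral_zero, mul_one] at h
  exact h.symm

/-- `D²λ` vanishes off the closed ball of radius `r₁` (`λ = ΔΓ∞` is supported in the annulus `r₀ ≤ |z| ≤ r₁`). [folklore] -/
theorem fderiv2_newtonFarLaplacian_eq_zero {r₀ r₁ : ℝ} (h₀ : 0 ≤ r₀) (h₁ : r₀ < r₁)
    {z : EuclideanSpace ℝ (Fin 3)} (hz : r₁ < ‖z‖) :
    fderiv ℝ (fderiv ℝ (newtonFarLaplacian r₀ r₁)) z = 0 := by
  have h1 : z ∉ tsupport (newtonFarLaplacian r₀ r₁) := fun h => by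
    have := tsupport_newtonFarLaplacian_subset h₀ h₁ h
    rw [mem_closedBall_zero_iff] at this
    linarith
  exact fderiv_of_notMem_tsupport ℝ fun h => h1 (tsupport_fderiv_subset ℝ h)

/-- Outside the topological support of `φ` the Hessian vanishes. [folklore] -/
theorem fderiv2_eq_zero_of_notMem_tsupport {φ : EuclideanSpace ℝ (Fin 3) → ℝ} {x : EuclideanSpace ℝ (Fin 3)} (hx : x ∉ tsupport φ) :
    fderiv ℝ (fderiv ℝ φ) x = 0 :=
  fderiv_of_notMem_tsupport ℝ fun h => hx (tsupport_fderiv_subset ℝ h)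

/-- A compactly supported function has its support in an OPEN ball of radius `≥ 1`. [folklore] -/
theorem exists_tsupport_subset_ball {φ : EuclideanSpace ℝ (Fin 3) → ℝ} (hφc : HasCompactSupport φ) :
    ∃ N : ℝ, 1 ≤ N ∧ tsupport φ ⊆ ball (0 : EuclideanSpace ℝ (Fin 3)) N := by
  obtain ⟨r, hr⟩ := hφc.isCompact.isBounded.subset_closedBall (0 : EuclideanSpace ℝ (Fin 3))
  refine ⟨max r 0 + 1, by linarith [le_max_right r 0], hr.trans ?_⟩
  exact closedBall_subset_ball (by linarith [le_max_left r 0])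

/-! ### Continuity of the witness -/

/-- **`Q[V]` is continuous** for `V ∈ C²` with the velocity budget (`ρ > −3/2`). [cite: Seregin2014, §6.2 Lemma 6.5] -/
theorem continuous_rieszMod {V : EuclideanSpace ℝ (Fin 3) → EuclideanSpace ℝ (Fin 3)} (hV : ContDiff ℝ 2 V) {ρ A : ℝ} (hρ : -3 / 2 < ρ)
    (hA : ∀ R : ℝ, 1 ≤ R → ∫ y in ball (0 : EuclideanSpace ℝ (Fin 3)) R, ‖V y‖ ^ 2 ≤ A * R ^ (1 - 2 * ρ)) :
    Continuous fun x => -nearPotential (1 / 2) 1 V x - farPotentialMod (1 / 2) 1 0 V x := by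
  have h1 : Continuous (nearPotential (1 / 2 : ℝ) 1 V) :=
    (contDiff_nearPotential (by norm_num) (by norm_num) 0 (by exact_mod_cast hV)).continuous
  have h2 : Continuous (farPotentialMod (1 / 2 : ℝ) 1 0 V) :=
    continuous_farPotentialMod_of_budget (by norm_num) (by norm_num) hV.continuous hρ hA 0
  exact h1.neg.sub h2

/-! ### Localisations -/

/-- **A `C²_c` localisation at scale `N`**: `w = χ V` with `χ` a smooth bump equal to `1` on `B̄(0,2N)` and supported in `B(0,3N)`; `w = V` on `B(0,2N)`
and `|w| ≤ |V|` pointwise. [folklore] -/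
theorem exists_localisation {V : EuclideanSpace ℝ (Fin 3) → EuclideanSpace ℝ (Fin 3)} (hV : ContDiff ℝ 2 V) {N : ℝ} (hN : 0 < N) :
    ∃ w : EuclideanSpace ℝ (Fin 3) → EuclideanSpace ℝ (Fin 3), ContDiff ℝ 2 w ∧ HasCompactSupport w ∧
      (∀ y ∈ ball (0 : EuclideanSpace ℝ (Fin 3)) (2 * N), w y = V y) ∧ ∀ y, ‖w y‖ ≤ ‖V y‖ := by
  let χ : ContDiffBump (0 : EuclideanSpace ℝ (Fin 3)) := ⟨2 * N, 3 * N, by positivity, by linarith⟩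
  refine ⟨fun y => χ y • V y, (χ.contDiff (n := 2)).smul hV, χ.hasCompactSupport.smul_right, fun y hy => ?_, fun y => ?_⟩
  · have h1 : χ y = 1 := χ.one_of_mem_closedBall (by
      rw [mem_closedBall, dist_zero_right]
      exact (mem_ball_zero_iff.1 hy).le)
    simp [h1]
  · rw [norm_smul, Real.norm_of_nonneg (χ.nonneg)]
    exact mul_le_of_le_one_left (norm_nonneg _) χ.le_one

/-! ### The renormalised far difference is weakly harmonic on `B(0, N)` -/

/-- **Weak harmonicity of the renormalised far difference**: for `V ∈ C²` with the budget (`ρ > −3/2`), a `C²_c` localisation `w = V` on `B(0,2N)` with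
`|w| ≤ |V|` (`N ≥ 1`) and a test function with `tsupport φ ⊆ B(0,N)`,
`∫ (∫ [(D²Γ∞(x−y) − D²Γ∞(0−y))(V y,V y) − (D²Γ∞(x−y) − D²Γ∞(0−y))(w y,w y)] dy) Δφ(x) dx = 0` (radii `(½,1)`): Fubini (dominator
`2M(1+N)⁴N·|Δφ(x)|·(1+|y|)⁻⁴|V y|²`), then for each `y` Green's identity turns `Δφ` into `φ` against `D²λ(x−y)`, which vanishes for `|y| ≥ 2N`, `|x| < N`
(`|x−y| > 1`), while for `|y| < 2N` the two tensors coincide. [cite: GilbargTrudinger2001, Lemma 4.2] -/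
theorem integral_farDifference_mul_laplacian_eq_zero {V : EuclideanSpace ℝ (Fin 3) → EuclideanSpace ℝ (Fin 3)} (hV : ContDiff ℝ 2 V)
    {ρ A : ℝ} (hρ : -3 / 2 < ρ)
    (hA : ∀ R : ℝ, 1 ≤ R → ∫ y in ball (0 : EuclideanSpace ℝ (Fin 3)) R, ‖V y‖ ^ 2 ≤ A * R ^ (1 - 2 * ρ))
    {N : ℝ} (hN : 1 ≤ N) {w : EuclideanSpace ℝ (Fin 3) → EuclideanSpace ℝ (Fin 3)} (hw : ContDiff ℝ 2 w)
    (hwV : ∀ y ∈ ball (0 : EuclideanSpace ℝ (Fin 3)) (2 * N), w y = V y) (hle : ∀ y, ‖w y‖ ≤ ‖V y‖)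
    {φ : EuclideanSpace ℝ (Fin 3) → ℝ} (hφ : ContDiff ℝ 2 φ) (hφc : HasCompactSupport φ)
    (hφN : tsupport φ ⊆ ball (0 : EuclideanSpace ℝ (Fin 3)) N) :
    ∫ x, (∫ y, ((fderiv ℝ (fderiv ℝ (newtonFar (1 / 2) 1)) (x - y) - fderiv ℝ (fderiv ℝ (newtonFar (1 / 2) 1)) (0 - y)) (V y) (V y) -
        (fderiv ℝ (fderiv ℝ (newtonFar (1 / 2) 1)) (x - y) - fderiv ℝ (fderiv ℝ (newtonFar (1 / 2) 1)) (0 - y)) (w y) (w y))) * (Δ φ) x = 0 := by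
  have h₀ : (0 : ℝ) < 1 / 2 := by norm_num
  have h₁ : (1 / 2 : ℝ) < 1 := by norm_num
  have hN0 : 0 < N := by linarith
  set K := fderiv ℝ (fderiv ℝ (newtonFar (1 / 2 : ℝ) 1)) with hK
  set L := fderiv ℝ (fderiv ℝ (newtonFarLaplacian (1 / 2 : ℝ) 1)) with hL
  have hVc : Continuous V := hV.continuous
  have hwc' : Continuous w := hw.continuous
  have hKc : Continuous K := (contDiff_fderiv2_newtonFar h₀ h₁).continuous
  have hlam : ContDiff ℝ 2 (newtonFarLaplacian (1 / 2 : ℝ) 1) := contDiff_newtonFarLaplacian h₀ h₁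
  have hLc : Continuous L := (hlam.fderiv_right (m := 1) le_rfl).continuous_fderiv one_ne_zero
  have hΔφc : Continuous (Δ φ) := FluidPDE.continuous_laplacian hφ
  have hΔφs : HasCompactSupport (Δ φ) := hφc.mono' fun x hx => by
    contrapose! hx
    simp [FluidPDE.laplacian_eq_zero_of_notMem_tsupport hx]
  have hsuppΔ : ∀ x, (Δ φ) x ≠ 0 → ‖x‖ < N := fun x hx => by
    by_contra h
    exact hx (FluidPDE.laplacian_eq_zero_of_notMem_tsupport fun h' => h (mem_ball_zero_iff.1 (hφN h')))
  have hsuppφ : ∀ x, φ x ≠ 0 → ‖x‖ < N := fun x hx => mem_ball_zero_iff.1 (hφN (subset_tsupport _ hx))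
  -- the integrand and its dominator
  obtain ⟨M, hM0, hM⟩ := exists_norm_farIntegrand_le h₀ h₁
  have hW := integrable_normSq_weight_of_budget hVc hρ hA
  set C : ℝ := 2 * (M * (1 + N) ^ 4 * N) with hC
  have hprod : Integrable (fun p : EuclideanSpace ℝ (Fin 3) × EuclideanSpace ℝ (Fin 3) =>
      ((K (p.1 - p.2) - K (0 - p.2)) (V p.2) (V p.2) - (K (p.1 - p.2) - K (0 - p.2)) (w p.2) (w p.2)) * (Δ φ) p.1)
      (volume.prod volume) := by
    have hcont : Continuous fun p : EuclideanSpace ℝ (Fin 3) × EuclideanSpace ℝ (Fin 3) =>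
        ((K (p.1 - p.2) - K (0 - p.2)) (V p.2) (V p.2) - (K (p.1 - p.2) - K (0 - p.2)) (w p.2) (w p.2)) * (Δ φ) p.1 :=
      ((continuous_farIntegrand_uncurry h₀ h₁ hVc 0).sub (continuous_farIntegrand_uncurry h₀ h₁ hwc' 0)).mul
        (hΔφc.comp continuous_fst)
    have hdom : Integrable (fun p : EuclideanSpace ℝ (Fin 3) × EuclideanSpace ℝ (Fin 3) =>
        ‖(Δ φ) p.1‖ * (C * (‖V p.2‖ ^ 2 * ((1 + ‖p.2‖) ^ 4)⁻¹))) (volume.prod volume) :=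
      (hΔφc.integrable_of_hasCompactSupport hΔφs).norm.mul_prod (hW.const_mul C)
    refine hdom.mono' hcont.aestronglyMeasurable (Eventually.of_forall fun p => ?_)
    rw [norm_mul]
    by_cases hp : (Δ φ) p.1 = 0
    · simp [hp]
    · have hp1 : ‖p.1‖ ≤ N := (hsuppΔ p.1 hp).le
      have h0N : ‖(0 : EuclideanSpace ℝ (Fin 3))‖ ≤ N := by rw [norm_zero]; exact hN0.le
      have hbV := hM V N p.1 0 p.2 hp1 h0N
      have hbw := hM w N p.1 0 p.2 hp1 h0N
      rw [sub_zero] at hbV hbw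
      have hwle : ‖w p.2‖ ^ 2 * ((1 + ‖p.2‖) ^ 4)⁻¹ ≤ ‖V p.2‖ ^ 2 * ((1 + ‖p.2‖) ^ 4)⁻¹ :=
        mul_le_mul_of_nonneg_right (pow_le_pow_left₀ (norm_nonneg _) (hle p.2) 2) (by positivity)
      have h4 : 0 ≤ ‖V p.2‖ ^ 2 * ((1 + ‖p.2‖) ^ 4)⁻¹ := by positivity
      have hb' : ‖(K (p.1 - p.2) - K (0 - p.2)) (V p.2) (V p.2) - (K (p.1 - p.2) - K (0 - p.2)) (w p.2) (w p.2)‖ ≤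
          C * (‖V p.2‖ ^ 2 * ((1 + ‖p.2‖) ^ 4)⁻¹) := by
        refine (norm_sub_le _ _).trans ?_
        refine (add_le_add hbV (hbw.trans (mul_le_mul_of_nonneg_left hwle (by positivity)))).trans ?_
        rw [hC]
        have : M * (1 + N) ^ 4 * ‖p.1‖ ≤ M * (1 + N) ^ 4 * N := mul_le_mul_of_nonneg_left hp1 (by positivity)
        nlinarith
      rw [mul_comm]
      exact mul_le_mul_of_nonneg_left hb' (norm_nonneg _)
  -- Step 1: Fubini
  have step1 : ∫ x, (∫ y, ((K (x - y) - K (0 - y)) (V y) (V y) - (K (x - y) - K (0 - y)) (w y) (w y))) * (Δ φ) x =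
      ∫ y, ∫ x, ((K (x - y) - K (0 - y)) (V y) (V y) - (K (x - y) - K (0 - y)) (w y) (w y)) * (Δ φ) x := by
    simp_rw [← integral_mul_const]
    exact integral_integral_swap hprod
  rw [step1]
  -- Step 2: the inner `x`-integral vanishes for every `y`
  have step2 : ∀ y, ∫ x, ((K (x - y) - K (0 - y)) (V y) (V y) - (K (x - y) - K (0 - y)) (w y) (w y)) * (Δ φ) x = 0 := by
    intro y
    have green : ∀ a : EuclideanSpace ℝ (Fin 3), ∫ x, (K (x - y) - K (0 - y)) a a * (Δ φ) x = ∫ x, L (x - y) a a * φ x := by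
      intro a
      have i1 : Integrable fun x => K (x - y) a a * (Δ φ) x :=
        ((((hKc.comp (continuous_id.sub continuous_const)).clm_apply continuous_const).clm_apply
          continuous_const).mul hΔφc).integrable_of_hasCompactSupport hΔφs.mul_left
      have i2 : Integrable fun x => K (0 - y) a a * (Δ φ) x :=
        (continuous_const.mul hΔφc).integrable_of_hasCompactSupport hΔφs.mul_left
      have e : ∀ x, (K (x - y) - K (0 - y)) a a * (Δ φ) x = K (x - y) a a * (Δ φ) x - K (0 - y) a a * (Δ φ) x := fun x => by
        simp only [sub_apply]; ring
      simp_rw [e]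
      rw [integral_sub i1 i2, integral_const_mul, integral_laplacian_eq_zero hφ hφc, mul_zero, sub_zero]
      exact integral_fderiv2_newtonFar_apply_mul_laplacian h₀ h₁ hφ hφc y a
    have iV : Integrable fun x => (K (x - y) - K (0 - y)) (V y) (V y) * (Δ φ) x :=
      (((((hKc.comp (continuous_id.sub continuous_const)).sub continuous_const).clm_apply continuous_const).clm_apply
        continuous_const).mul hΔφc).integrable_of_hasCompactSupport hΔφs.mul_left
    have iw : Integrable fun x => (K (x - y) - K (0 - y)) (w y) (w y) * (Δ φ) x :=
      (((((hKc.comp (continuous_id.sub continuous_const)).sub continuous_const).clm_apply continuous_const).clm_apply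
        continuous_const).mul hΔφc).integrable_of_hasCompactSupport hΔφs.mul_left
    simp_rw [sub_mul]
    rw [integral_sub iV iw, green (V y), green (w y), sub_eq_zero]
    by_cases hy : ‖y‖ < 2 * N
    · rw [hwV y (mem_ball_zero_iff.2 hy)]
    · refine integral_congr_ae (Eventually.of_forall fun x => ?_)
      by_cases hφx : φ x = 0
      · simp [hφx]
      · have hx : ‖x‖ < N := hsuppφ x hφx
        have hz : (1 : ℝ) < ‖x - y‖ := by
          have := norm_sub_norm_le y x
          rw [norm_sub_rev] at this
          rw [not_lt] at hy
          linarith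
        have hz0 : L (x - y) = 0 := by
          rw [hL]; exact fderiv2_newtonFarLaplacian_eq_zero h₀.le h₁ hz
        simp only [hz0, zero_apply, zero_mul]
  simp_rw [step2, integral_zero]


/-! ### The weak pressure Poisson equation for the witness -/

/-- ★ **THE WEAK PRESSURE POISSON EQUATION** for `Q[V] = −Q₁^{½,1}[V] − farPotentialMod ½ 1 0 V` (`V ∈ C²` with the velocity budget, `ρ > −3/2`):
`∫ Q[V] Δφ = −∫ D²φ(V, V)` for every `φ ∈ C^∞_c`.  On `tsupport φ ⊆ B(0,N)` the localisation identity gives `Q[V] = p̃[w_N] + κ − E` with `w_N` a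
`C²_c` localisation at scale `N`; `∫ p̃[w_N] Δφ = −∫ D²φ(w_N,w_N) = −∫ D²φ(V,V)` (tree, Stein/NRS weak equation for compactly supported fields), `∫Δφ = 0`,
and `∫ E Δφ = 0` (`integral_farDifference_mul_laplacian_eq_zero`). [cite: Seregin2014, §6.2 Lemma 6.5; Tao2011, (35)] -/
theorem integral_rieszMod_mul_laplacian {V : EuclideanSpace ℝ (Fin 3) → EuclideanSpace ℝ (Fin 3)} (hV : ContDiff ℝ 2 V) {ρ A : ℝ}
    (hρ : -3 / 2 < ρ)
    (hA : ∀ R : ℝ, 1 ≤ R → ∫ y in ball (0 : EuclideanSpace ℝ (Fin 3)) R, ‖V y‖ ^ 2 ≤ A * R ^ (1 - 2 * ρ))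
    {φ : EuclideanSpace ℝ (Fin 3) → ℝ} (hφ : ContDiff ℝ ∞ φ) (hφc : HasCompactSupport φ) :
    ∫ x, (-nearPotential (1 / 2) 1 V x - farPotentialMod (1 / 2) 1 0 V x) * (Δ φ) x =
      -∫ x, fderiv ℝ (fderiv ℝ φ) x (V x) (V x) := by
  have h₀ : (0 : ℝ) < 1 / 2 := by norm_num
  have h₁ : (1 / 2 : ℝ) < 1 := by norm_num
  have hφ2 : ContDiff ℝ 2 φ := hφ.of_le (WithTop.coe_le_coe.2 le_top)
  have hΔφc : Continuous (Δ φ) := FluidPDE.continuous_laplacian hφ2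
  have hΔφs : HasCompactSupport (Δ φ) := hφc.mono' fun x hx => by
    contrapose! hx
    simp [FluidPDE.laplacian_eq_zero_of_notMem_tsupport hx]
  -- the scale `N` and the localisation
  obtain ⟨N, hN, hφN⟩ := exists_tsupport_subset_ball hφc
  have hN0 : 0 < N := by linarith
  obtain ⟨w, hw, hwc, hwV, hle⟩ := exists_localisation hV hN0
  set K := fderiv ℝ (fderiv ℝ (newtonFar (1 / 2 : ℝ) 1)) with hK
  set Q : EuclideanSpace ℝ (Fin 3) → ℝ := fun x => -nearPotential (1 / 2) 1 V x - farPotentialMod (1 / 2) 1 0 V x with hQ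
  set κ : ℝ := farPotential (1 / 2) 1 w 0 with hκ
  set E : EuclideanSpace ℝ (Fin 3) → ℝ := fun x => ∫ y, ((K (x - y) - K (0 - y)) (V y) (V y) -
    (K (x - y) - K (0 - y)) (w y) (w y)) with hE
  -- the pointwise identity on the support
  have hpt : ∀ x, Q x * (Δ φ) x = (normalisedPressure w x + κ - E x) * (Δ φ) x := by
    intro x
    by_cases hx : x ∈ ball (0 : EuclideanSpace ℝ (Fin 3)) N
    · have hid := rieszMod_sub_normalisedPressure_eq hV hρ hA hN hw hwc hwV hx
      have : Q x = normalisedPressure w x + κ - E x := by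
        rw [hQ, hκ, hE]
        dsimp only
        rw [hK] at *
        linarith
      rw [this]
    · have hx' : x ∉ tsupport φ := fun h => hx (hφN h)
      simp [FluidPDE.laplacian_eq_zero_of_notMem_tsupport hx']
  -- the budget for the localisation (`|w| ≤ |V|`)
  have hAw : ∀ R : ℝ, 1 ≤ R → ∫ y in ball (0 : EuclideanSpace ℝ (Fin 3)) R, ‖w y‖ ^ 2 ≤ A * R ^ (1 - 2 * ρ) := by
    intro R hR
    refine le_trans (setIntegral_mono_on ?_ ?_ measurableSet_ball fun y _ => ?_) (hA R hR)
    · exact ((hw.continuous.norm.pow 2).continuousOn.integrableOn_compact (isCompact_closedBall 0 R)).mono_set ball_subset_closedBall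
    · exact ((hV.continuous.norm.pow 2).continuousOn.integrableOn_compact (isCompact_closedBall 0 R)).mono_set ball_subset_closedBall
    · exact pow_le_pow_left₀ (norm_nonneg _) (hle y) 2
  -- continuity of `E` (difference of two renormalised far potentials) and of `p̃[w]`
  have hEeq : E = fun x => farPotentialMod (1 / 2) 1 0 V x - farPotentialMod (1 / 2) 1 0 w x := by
    funext x
    rw [hE]
    dsimp only
    unfold farPotentialMod
    rw [← hK, ← integral_sub (integrable_farIntegrand_of_budget h₀ h₁ hV.continuous hρ hA 0 x)
      (integrable_farIntegrand_of_budget h₀ h₁ hw.continuous hρ hAw 0 x)]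
  have hEc : Continuous E := by
    rw [hEeq]
    exact (continuous_farPotentialMod_of_budget h₀ h₁ hV.continuous hρ hA 0).sub
      (continuous_farPotentialMod_of_budget h₀ h₁ hw.continuous hρ hAw 0)
  have hpc : Continuous (normalisedPressure w) := continuous_normalisedPressure_of_contDiff_two hw hwc
  have i1 : Integrable fun x => normalisedPressure w x * (Δ φ) x := (hpc.mul hΔφc).integrable_of_hasCompactSupport hΔφs.mul_left
  have i2 : Integrable fun x => κ * (Δ φ) x := (continuous_const.mul hΔφc).integrable_of_hasCompactSupport hΔφs.mul_left
  have i3 : Integrable fun x => E x * (Δ φ) x := (hEc.mul hΔφc).integrable_of_hasCompactSupport hΔφs.mul_left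
  -- assemble
  have e1 : ∀ x, (normalisedPressure w x + κ - E x) * (Δ φ) x =
      normalisedPressure w x * (Δ φ) x + κ * (Δ φ) x - E x * (Δ φ) x := fun x => by ring
  show ∫ x, Q x * (Δ φ) x = -∫ x, fderiv ℝ (fderiv ℝ φ) x (V x) (V x)
  simp_rw [hpt, e1]
  have i12 : Integrable fun x => normalisedPressure w x * (Δ φ) x + κ * (Δ φ) x := i1.add i2
  rw [integral_sub i12 i3, integral_add i1 i2, integral_const_mul, integral_laplacian_eq_zero hφ2 hφc, mul_zero, add_zero]
  have hE0 : ∫ x, E x * (Δ φ) x = 0 := by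
    rw [hE]
    exact integral_farDifference_mul_laplacian_eq_zero hV hρ hA hN hw hwV hle hφ2 hφc hφN
  rw [hE0, sub_zero]
  -- the weak equation of the near pressure of the compactly supported field `w`
  have hw4 : MemLp w (2 * 2) volume := hw.continuous.memLp_of_hasCompactSupport hwc
  rw [integral_normalisedPressure_mul_laplacian_of_memLp (p := 2) (by norm_num) (by simp) hw4 hφ hφc]
  congr 1
  refine integral_congr_ae (Eventually.of_forall fun x => ?_)
  show fderiv ℝ (fderiv ℝ φ) x (w x) (w x) = fderiv ℝ (fderiv ℝ φ) x (V x) (V x)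
  by_cases hx : x ∈ ball (0 : EuclideanSpace ℝ (Fin 3)) N
  · have hx2 : x ∈ ball (0 : EuclideanSpace ℝ (Fin 3)) (2 * N) := by
      rw [mem_ball_zero_iff] at hx ⊢; linarith
    rw [hwV x hx2]
  · have hx' : x ∉ tsupport φ := fun h => hx (hφN h)
    simp [fderiv2_eq_zero_of_notMem_tsupport hx']

/-! ### ★★ S4 `RieszModConst ρ` -/

/-- ★★ **S4 `NsregP2.R58c.RieszModConst ρ` VERBATIM** (defs `VelocityBudget`, `SolvesPressurePoisson` δ-unfolded; the harmonic-analysis heart of t60-ΠLOG, NO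
logarithm): for a `C²` field `V` with the dyadic `L²` velocity budget `∫_{B_R}|V|² ≤ A R^{1−2ρ}` (`R ≥ 1`) and `ρ > −3/2` there is a Riesz pressure MODULO
CONSTANTS `Q` — locally integrable, solving `∫ Q Δφ = −∫ D²φ(V,V)` for all `φ ∈ C^∞_c` — such that at every scale `R ≥ 1`, for every `C²_c` localisation `w`
(`w = V` on `B_{2R}`, `|w| ≤ |V|`), there is a constant `c` with `|Q − c − p̃[w]| ≤ D R^{−2−2ρ}` a.e. on `B_R` (here: everywhere on `B_R`).
Witness `Q = −Q₁^{½,1}[V] − farPotentialMod ½ 1 0 V`, `c = Q₂^{½,1}[w](0)`, `D = 2·M·C_ρ·A` with `M` the sharp two-centre constant of `D²Γ∞` and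
`C_ρ = 2^{1−2ρ}2^{−3−2ρ}/(1−2^{−3−2ρ})` the dyadic tail constant.  Consumer: ns-ezl-w3's `scaleRepAssembly` (S58c-A) → `ScaleRepresentation ρ` → t60-ΠLOG.
[nsreg-p2 R58 `r58/Sketch58c.lean` §1 S4; cite: Seregin2014, §6.2 Lemma 6.5; GilbargTrudinger2001, Lemma 4.2; Stein1970, Ch. II §2 Thm 1 (b)] -/
theorem rieszModConst (ρ : ℝ) :
    ∀ V : EuclideanSpace ℝ (Fin 3) → EuclideanSpace ℝ (Fin 3), ContDiff ℝ 2 V →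
      (∃ A : ℝ, ∀ R : ℝ, 1 ≤ R → ∫ y in ball (0 : EuclideanSpace ℝ (Fin 3)) R, ‖V y‖ ^ 2 ≤ A * R ^ (1 - 2 * ρ)) → -3 / 2 < ρ →
      ∃ Q : EuclideanSpace ℝ (Fin 3) → ℝ, LocallyIntegrable Q volume ∧
        (∀ φ : EuclideanSpace ℝ (Fin 3) → ℝ, ContDiff ℝ (⊤ : ℕ∞) φ → HasCompactSupport φ →
          ∫ x, Q x * (Δ φ) x = -∫ x, fderiv ℝ (fderiv ℝ φ) x (V x) (V x)) ∧
        ∃ D : ℝ, ∀ R : ℝ, 1 ≤ R → ∀ w : EuclideanSpace ℝ (Fin 3) → EuclideanSpace ℝ (Fin 3), ContDiff ℝ 2 w → HasCompactSupport w →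
          (∀ y ∈ ball (0 : EuclideanSpace ℝ (Fin 3)) (2 * R), w y = V y) → (∀ y, ‖w y‖ ≤ ‖V y‖) →
          ∃ c : ℝ, ∀ᵐ x ∂(volume.restrict (ball (0 : EuclideanSpace ℝ (Fin 3)) R)),
            |Q x - c - normalisedPressure w x| ≤ D * R ^ (-2 - 2 * ρ) := by
  intro V hV hA hρ
  obtain ⟨A, hA⟩ := hA
  obtain ⟨M, hM0, hM⟩ := exists_norm_fderiv2_newtonFar_sub_le_of_two_mul_le (r₀ := (1 / 2 : ℝ)) (r₁ := 1) (by norm_num) (by norm_num)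
  refine ⟨fun x => -nearPotential (1 / 2) 1 V x - farPotentialMod (1 / 2) 1 0 V x,
    (continuous_rieszMod hV hρ hA).locallyIntegrable, fun φ hφ hφc => integral_rieszMod_mul_laplacian hV hρ hA hφ hφc,
    2 * M * ((2 : ℝ) ^ (1 - 2 * ρ) * ((2 : ℝ) ^ (-3 - 2 * ρ) / (1 - 2 ^ (-3 - 2 * ρ)))) * A, fun R hR w hw hwc hwV hle => ?_⟩
  refine ⟨farPotential (1 / 2) 1 w 0, (ae_restrict_iff' measurableSet_ball).2 (Eventually.of_forall fun x hx => ?_)⟩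
  exact abs_rieszMod_sub_normalisedPressure_le hV hρ hA hM0 hM hR hw hwc hwV hle hx

end Summit.NavierStokesRegularity.NavierStokesRegularity.Theorems.PowerGaugeEulerLiouville.PressureSeam

end
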